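import Literature.NumberTheory.EllipticCurves.CongruentNumberMonskySelmerRankZero
import HarnessLib

/-!
# Heath-Brown's «fundamental inequality `r(D) ≤ s(D)`» as an UNCONDITIONAL tree theorem, and `r(D) = s(D) ⟹ Ш(E_D)[2^∞] = 0`

Topic `NumberTheory/EllipticCurves`; namespace `Literature.NumberTheory.EllipticCurves.CongruentNumberMonskySelmer`. A pure proof file.

Heath-Brown, Invent. Math. 118 (1994) §1 (typescript p. 1 L14–L20): "We shall therefore write `#S⁽²⁾ = 2^{2+s(D)}`. … Since one
has the fundamental inequality `r(D) ≤ s(D)`, …". With `s(D)` Monsky's matrix rank (`monskySelmerRank{Odd,Even}`, appendix pp. 39–41)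
and the UPPER BOUND `#Sel⁽²⁾(E_D/ℚ) ≤ 2^{2+s(D)}` now a tree theorem for every square-free `D` (`CongruentNumber{Odd,Even}MonskySelmerBound.lean`),
the descent count `#Sel₂ = 2^{rk}·#E_D(ℚ)[2]·#(Ш ⊓ H¹[2])` (Silverman X.4.2, tree theorem `natCard_selmerGroup_eq`) gives, UNCONDITIONALLY:

* `mordellWeilRank_le_of_card_selmerGroup_two_le` — for `E_N`: `#Sel₂ ≤ 2^{2+s} ⟹ rk E_N(ℚ) ≤ s`, and `rk = s ⟹ Ш(E_N)[2^∞] = 0`;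
* **`mordellWeilRank_le_monskySelmerRankOdd/Even`** — `rk E_D(ℚ) ≤ s(D)` for every square-free `D` (odd / even), `s(D)` Monsky's
  kernel-computable rank: the fundamental inequality, fact-free;
* **`primaryComponent_sha_two_eq_bot_of_mordellWeilRank_eq_monskySelmerRankOdd/Even`** — if the rank attains Monsky's bound then
  `Ш(E_D)[2^∞] = 0` (the shape used at `s = 1` by every rank-one door of the cell `bsd-monsky` and of the sub-lane «bsd-p2», now for all `s`).

Everything is proved; no named facts; nothing about any class is booked.

## References

* [HeathBrown1994SelmerCongruentII] D. R. Heath-Brown, Invent. Math. 118 (1994), §1 typescript p. 1 L14–L20 (`#S⁽²⁾ = 2^{2+s(D)}`, `r(D) ≤ s(D)`);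
  Appendix (P. Monsky) p. 39 L10–L33, p. 41 L20–L36.
* [SilvermanAEC2009] J. H. Silverman, *The Arithmetic of Elliptic Curves*, 2nd ed., Thm. X.4.2.
-/

noncomputable section

open scoped Classical

open WeierstrassCurve Literature.NumberTheory.EllipticCurves.HeathBrown1994

namespace Literature.NumberTheory.EllipticCurves

namespace CongruentNumberMonskySelmer

/-! ## §1 The descent count: `#Sel₂(E_N) ≤ 2^{2+s}` bounds the rank by `s`, with `Ш[2^∞] = 0` at equality -/

/-- **`#Sel⁽²⁾(E_N/ℚ) ≤ 2^{2+s} ⟹ rk E_N(ℚ) ≤ s`, and `rk = s ⟹ Ш(E_N)[2^∞] = 0`** (the descent count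
`#Sel₂ = 2^{rk}·#E_N(ℚ)[2]·#(Ш ⊓ H¹[2])` with `#E_N(ℚ)[2] = 4`). [cite: SilvermanAEC2009, Thm. X.4.2]
[cite: HeathBrown1994SelmerCongruentII, §1 typescript p. 1 L14–L20] -/
theorem mordellWeilRank_le_of_card_selmerGroup_two_le {N : ℕ} (hN : N ≠ 0) {s : ℕ}
    (hle : Nat.card ((congruentNumberCurve N).selmerGroup 2) ≤ 2 ^ (2 + s)) :
    haveI := isElliptic_congruentNumberCurve hN
    (congruentNumberCurve N).mordellWeilRank ≤ s ∧
      ((congruentNumberCurve N).mordellWeilRank = s → AddCommGroup.primaryComponent (congruentNumberCurve N).sha 2 = ⊥) := by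
  haveI := isElliptic_congruentNumberCurve hN
  haveI : Fact (Nat.Prime 2) := ⟨Nat.prime_two⟩
  have hle' : Nat.card ((congruentNumberCurve N).selmerGroup ((2 : ℕ) : ℤ)) ≤ 2 ^ (2 + s) := by
    simpa only [Nat.cast_ofNat] using hle
  haveI : Finite ((congruentNumberCurve N).sha ⊓ AddSubgroup.torsionBy (congruentNumberCurve N).galH1 ((2 : ℕ) : ℤ) :
      AddSubgroup (congruentNumberCurve N).galH1) := by
    haveI : Finite ((congruentNumberCurve N).selmerGroup ((2 : ℕ) : ℤ)) :=
      (congruentNumberCurve N).finite_selmerGroup_holds (by norm_num)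
    exact Nat.finite_of_card_ne_zero (fun h0 => by
      have hcard := (congruentNumberCurve N).natCard_selmerGroup_eq (n := 2) two_ne_zero
      rw [h0, mul_zero] at hcard
      exact (Nat.card_pos (α := (congruentNumberCurve N).selmerGroup ((2 : ℕ) : ℤ))).ne' hcard)
  have hS : 0 < Nat.card ((congruentNumberCurve N).sha ⊓
      AddSubgroup.torsionBy (congruentNumberCurve N).galH1 ((2 : ℕ) : ℤ) : AddSubgroup (congruentNumberCurve N).galH1) :=
    Nat.card_pos
  have hcard := (congruentNumberCurve N).natCard_selmerGroup_eq (n := 2) two_ne_zero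
  -- `2^r · 4 · S ≤ 2^(2+s) = 4 · 2^s`
  have key : ∀ {C R T S B : ℕ}, C = R * T * S → T = 4 → 0 < S → C ≤ 2 ^ (2 + B) → R * S ≤ 2 ^ B := by
    intro C R T S B hC hT hS h
    subst hT; subst hC
    rw [pow_add] at h
    nlinarith
  have hRS := key hcard (by convert Smith2016.natCard_torsionBy_two_congruentNumberCurve hN; norm_num) hS hle'
  set r := (congruentNumberCurve N).mordellWeilRank with hr
  have hr_le : r ≤ s := by
    by_contra hlt
    push Not at hlt
    have h1 : 2 ^ s < 2 ^ r := Nat.pow_lt_pow_right (by norm_num) hlt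
    have h2 : 2 ^ r ≤ 2 ^ r * Nat.card ((congruentNumberCurve N).sha ⊓
        AddSubgroup.torsionBy (congruentNumberCurve N).galH1 ((2 : ℕ) : ℤ) : AddSubgroup (congruentNumberCurve N).galH1) :=
      Nat.le_mul_of_pos_right _ hS
    omega
  refine ⟨hr_le, fun hrs => ?_⟩
  rw [hrs] at hRS
  have hS1 : Nat.card ((congruentNumberCurve N).sha ⊓
      AddSubgroup.torsionBy (congruentNumberCurve N).galH1 ((2 : ℕ) : ℤ) : AddSubgroup (congruentNumberCurve N).galH1) = 1 := by
    have h2s : 0 < 2 ^ s := pow_pos (by norm_num) s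
    have : Nat.card ((congruentNumberCurve N).sha ⊓
        AddSubgroup.torsionBy (congruentNumberCurve N).galH1 ((2 : ℕ) : ℤ) : AddSubgroup (congruentNumberCurve N).galH1) ≤ 1 := by
      by_contra hgt
      push Not at hgt
      have : 2 ^ s * 2 ≤ 2 ^ s * Nat.card ((congruentNumberCurve N).sha ⊓
          AddSubgroup.torsionBy (congruentNumberCurve N).galH1 ((2 : ℕ) : ℤ) : AddSubgroup (congruentNumberCurve N).galH1) :=
        Nat.mul_le_mul_left _ hgt
      omega
    omega
  exact primaryComponent_sha_eq_bot_of_inf_torsionBy_eq_bot (congruentNumberCurve N) 2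
    (AddSubgroup.eq_bot_of_card_eq _ hS1)

/-! ## §2 The fundamental inequality `r(D) ≤ s(D)` and `r = s ⟹ Ш[2^∞] = 0`, fact-free -/

variable {k : ℕ} (p : Fin k → ℕ)

/-- **`rk E_D(ℚ) ≤ s(D)` for odd square-free `D = p₁⋯p_k`** — Heath-Brown's fundamental inequality with Monsky's `s(D) = 2k − rank M`,
UNCONDITIONALLY (`#Sel₂ ≤ 2^{2+s}` is the tree's complete `2`-descent). [cite: HeathBrown1994SelmerCongruentII, §1 typescript p. 1 L14–L20; Appendix (Monsky) p. 39 L10–L33]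
[cite: SilvermanAEC2009, Thm. X.4.2] -/
theorem mordellWeilRank_le_monskySelmerRankOdd (hp : ∀ i, (p i).Prime) (hodd : ∀ i, Odd (p i))
    (hinj : Function.Injective p) :
    haveI := isElliptic_congruentNumberCurve (Squarefree.ne_zero (squarefree_prod_of_injective p hp hinj))
    (congruentNumberCurve (∏ i, p i)).mordellWeilRank ≤ monskySelmerRankOdd p :=
  (mordellWeilRank_le_of_card_selmerGroup_two_le (Squarefree.ne_zero (squarefree_prod_of_injective p hp hinj))
    (card_selmerGroup_two_le_pow_monskySelmerRankOdd k p hp hodd hinj)).1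

/-- **`rk E_D(ℚ) ≤ s(D)` for even square-free `D = 2p₁⋯p_k`**, UNCONDITIONALLY.
[cite: HeathBrown1994SelmerCongruentII, §1 typescript p. 1 L14–L20; Appendix (Monsky) p. 41 L20–L36] [cite: SilvermanAEC2009, Thm. X.4.2] -/
theorem mordellWeilRank_le_monskySelmerRankEven (hp : ∀ i, (p i).Prime) (hodd : ∀ i, Odd (p i))
    (hinj : Function.Injective p) :
    haveI := isElliptic_congruentNumberCurve (Squarefree.ne_zero (squarefree_two_mul_prod_of_injective p hp hodd hinj))
    (congruentNumberCurve (2 * ∏ i, p i)).mordellWeilRank ≤ monskySelmerRankEven p :=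
  (mordellWeilRank_le_of_card_selmerGroup_two_le (Squarefree.ne_zero (squarefree_two_mul_prod_of_injective p hp hodd hinj))
    (card_selmerGroup_two_le_pow_monskySelmerRankEven k p hp hodd hinj)).1

/-- **Odd `D`: if `rk E_D(ℚ) = s(D)` then `Ш(E_D)[2^∞] = 0`**, UNCONDITIONALLY (the `2`-descent is then sharp).
[cite: HeathBrown1994SelmerCongruentII, §1 typescript p. 1 L14–L20] [cite: SilvermanAEC2009, Thm. X.4.2] -/
theorem primaryComponent_sha_two_eq_bot_of_mordellWeilRank_eq_monskySelmerRankOdd (hp : ∀ i, (p i).Prime)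
    (hodd : ∀ i, Odd (p i)) (hinj : Function.Injective p)
    (hr : haveI := isElliptic_congruentNumberCurve (Squarefree.ne_zero (squarefree_prod_of_injective p hp hinj));
      (congruentNumberCurve (∏ i, p i)).mordellWeilRank = monskySelmerRankOdd p) :
    haveI := isElliptic_congruentNumberCurve (Squarefree.ne_zero (squarefree_prod_of_injective p hp hinj))
    AddCommGroup.primaryComponent (congruentNumberCurve (∏ i, p i)).sha 2 = ⊥ :=
  (mordellWeilRank_le_of_card_selmerGroup_two_le (Squarefree.ne_zero (squarefree_prod_of_injective p hp hinj))
    (card_selmerGroup_two_le_pow_monskySelmerRankOdd k p hp hodd hinj)).2 hr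

/-- **Even `D`: if `rk E_D(ℚ) = s(D)` then `Ш(E_D)[2^∞] = 0`**, UNCONDITIONALLY.
[cite: HeathBrown1994SelmerCongruentII, §1 typescript p. 1 L14–L20] [cite: SilvermanAEC2009, Thm. X.4.2] -/
theorem primaryComponent_sha_two_eq_bot_of_mordellWeilRank_eq_monskySelmerRankEven (hp : ∀ i, (p i).Prime)
    (hodd : ∀ i, Odd (p i)) (hinj : Function.Injective p)
    (hr : haveI := isElliptic_congruentNumberCurve (Squarefree.ne_zero (squarefree_two_mul_prod_of_injective p hp hodd hinj));
      (congruentNumberCurve (2 * ∏ i, p i)).mordellWeilRank = monskySelmerRankEven p) :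
    haveI := isElliptic_congruentNumberCurve (Squarefree.ne_zero (squarefree_two_mul_prod_of_injective p hp hodd hinj))
    AddCommGroup.primaryComponent (congruentNumberCurve (2 * ∏ i, p i)).sha 2 = ⊥ :=
  (mordellWeilRank_le_of_card_selmerGroup_two_le
    (Squarefree.ne_zero (squarefree_two_mul_prod_of_injective p hp hodd hinj))
    (card_selmerGroup_two_le_pow_monskySelmerRankEven k p hp hodd hinj)).2 hr

end CongruentNumberMonskySelmer

end Literature.NumberTheory.EllipticCurves

end
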